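/-
HONEST FRAMING: exact (Metropolis-corrected) sampling algorithms for lattice gauge theory; figures of merit
are autocorrelation/cost numbers at stated couplings and volumes; no continuum-physics claim.
-/
import Mathlib
import Summits.Ventures.LatticeQCDFlow.TrivializingMaps.GradedEmission
import Summits.Ventures.LatticeQCDFlow.TrivializingMaps.PlaquetteComplex

/-!
# The step of the graded Lüscher series is a mass-transfer step (THEORY-1 §19, step (6c))

Venture-side (`Summits/Ventures/LatticeQCDFlow/`), never `Literature/`.  We instantiate the tree's abstract
ONE-STEP CONTRACTION (`MassTransferContraction.linkMass_le`) for the step `G ↦ G.step` of the graded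
series:

* (the plaquette link complex `plaqComplex`, `D = 4d²`, is in `PlaquetteComplex.lean`;)
* mode weights on `G.I ⊕ G.CIdx` (parents and children): `w = √(m_e)`, `c = c(m)`, `κ = √(n/4)`
  (`Gen.weights`); transfer amounts `T p e' (inl i) (inr j) = c(m_j) ν_j` if the child `j` was produced from
  the parent `i` at `(p, e')` and `0` otherwise (`Gen.trM`);
* `Gen.isTransferStep`: (T1) balance, (T2) emission with `Γ = n⁴ τ_*/2` (`GradedEmission`), (T3) locality
  with `σ = σ_*` (the tensor-shift lemma E8 of `TensorShift`), (G) the gap `γ = n/4` (`SlotCasimirGap`);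
* hence `N_{G.step}(e) ≤ θ · sup_e N_G(e)` with the VOLUME-INDEPENDENT rate
  `θ = 4d² · Γ · (1/κ + 8σ_*/γ)` (`Gen.step_mass_le`).

0 sorry. [ours]
-/

namespace Summit.Ventures.LatticeQCDFlow.TrivializingMaps.GradedSeries

open scoped ComplexConjugate Matrix Matrix.Norms.Frobenius InnerProductSpace ContDiff
open Finset
open Literature.MathematicalPhysics.QuantumFieldTheory
open Literature.MathematicalPhysics.QuantumFieldTheory.Luscher2010
open SlotRepresentation SlotCasimir SlotCoefficient SlotHilbert JointGrading CasimirGrading PlaquetteData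
  SlotTensor TensorShift RankOne Vertex MassTransfer

variable {d L n : ℕ} [NeZero L]

/-! ## 1. Mode weights and transfer amounts of a step -/

namespace Gen
variable {B : SuBasis n} {σ : Type} [Fintype σ] [DecidableEq σ] (G : Gen (d := d) (L := L) B σ)

/-- Mode weights on parents `⊕` children: `w = √(m_e)`, `c = c(m)`, `κ = √(n/4)`. [ours] -/
noncomputable def weights (hn : n ≠ 0) : ModeWeights (Edge d L) (G.I ⊕ G.CIdx) where
  w := Sum.elim G.wt G.step.wt
  w_nonneg := fun m e => by
    cases m
    · exact G.wt_nonneg _ e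
    · exact G.step.wt_nonneg _ e
  c := Sum.elim G.cm G.step.cm
  κ := Real.sqrt ((n : ℝ) / 4)
  κ_pos := Real.sqrt_pos.2 (div_pos (Nat.cast_pos.2 (Nat.pos_of_ne_zero hn)) four_pos)
  casimir_ge := fun m => by
    cases m
    · exact G.sqrt_quarter_mul_sum_wt_le _
    · exact G.step.sqrt_quarter_mul_sum_wt_le _

open Classical in
/-- The amount transferred from parent `i` to child `j` at `(p, e')`: `c(m_j) ν_j` if `j` was produced from
`i` at `(p, e')`, else `0`. [ours] -/
noncomputable def tr (p : Site d L × Fin d × Fin d) (e' : Edge d L) (i : G.I) (j : G.CIdx) : ℝ :=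
  if j.1 = e' then (if j.2.2.1 = i then (if j.2.2.2.1 = p then G.step.cm j * G.step.nu j else 0) else 0)
  else 0

open Classical in
/-- `tr` on an explicit child index. [ours] -/
theorem tr_mk (p : Site d L × Fin d × Fin d) (e' : Edge d L) (i : G.I) (e₁ : Edge d L) (a : B.ι) (i₁ : G.I)
    (p₁ : Site d L × Fin d × Fin d) (b : Bool) (c : Fin n × Fin n × Fin n × Fin n) (mo : G.CModes i₁ p₁ b) :
    G.tr p e' i ⟨e₁, a, i₁, p₁, b, c, mo⟩ = if e₁ = e' then (if i₁ = i then (if p₁ = p then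
      G.step.cm ⟨e₁, a, i₁, p₁, b, c, mo⟩ * G.step.nu ⟨e₁, a, i₁, p₁, b, c, mo⟩ else 0) else 0) else 0 :=
  rfl

open Classical in
/-- Case analysis of `tr`. [ours] -/
theorem tr_cases (p : Site d L × Fin d × Fin d) (e' : Edge d L) (i : G.I) (j : G.CIdx) :
    G.tr p e' i j = 0 ∨
      (j.1 = e' ∧ j.2.2.1 = i ∧ j.2.2.2.1 = p ∧ G.tr p e' i j = G.step.cm j * G.step.nu j) := by
  unfold tr
  by_cases h1 : j.1 = e'
  · by_cases h2 : j.2.2.1 = i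
    · by_cases h3 : j.2.2.2.1 = p
      · right; exact ⟨h1, h2, h3, by rw [if_pos h1, if_pos h2, if_pos h3]⟩
      · left; rw [if_pos h1, if_pos h2, if_neg h3]
    · left; rw [if_pos h1, if_neg h2]
  · left; rw [if_neg h1]

/-- `tr ≥ 0`. [ours] -/
theorem tr_nonneg (p : Site d L × Fin d × Fin d) (e' : Edge d L) (i : G.I) (j : G.CIdx) :
    0 ≤ G.tr p e' i j := by
  rcases G.tr_cases p e' i j with h | ⟨_, _, _, h⟩
  · rw [h]
  · rw [h]; exact mul_nonneg (G.step.cm_nonneg j) (G.step.nu_nonneg j)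

/-- The transfer amounts on `G.I ⊕ G.CIdx` (parents to children only). [ours] -/
noncomputable def trM (p : Site d L × Fin d × Fin d) (e' : Edge d L) : G.I ⊕ G.CIdx → G.I ⊕ G.CIdx → ℝ :=
  Sum.elim (fun i => Sum.elim (fun _ => 0) (G.tr p e' i)) (fun _ _ => 0)

/-- A nonzero transfer amount goes from a parent to a child. [ours] -/
theorem trM_ne_zero {p : Site d L × Fin d × Fin d} {e' : Edge d L} {nn mm : G.I ⊕ G.CIdx}
    (h : G.trM p e' nn mm ≠ 0) : ∃ i j, nn = Sum.inl i ∧ mm = Sum.inr j ∧ G.tr p e' i j ≠ 0 := by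
  rcases nn with i | j
  · rcases mm with i' | j'
    · exact absurd rfl h
    · exact ⟨i, j', rfl, rfl, h⟩
  · exact absurd rfl h

/-- The mass of child `j` is nonzero only if its projected new bra is. [ours] -/
theorem proj_cv_ne_zero (e₁ : Edge d L) (a : B.ι) (i₁ : G.I) (p₁ : Site d L × Fin d × Fin d) (b : Bool)
    (c : Fin n × Fin n × Fin n × Fin n) (mo : G.CModes i₁ p₁ b)
    (h : G.step.nu ⟨e₁, a, i₁, p₁, b, c, mo⟩ ≠ 0) :
    jointProj (casimirFamily (Sum.elim (plaqIdx p₁.1 p₁.2.1 p₁.2.2) (G.lnk i₁)) (Sum.elim (polB b) (G.pol i₁)) B)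
      mo (tens (genCLM (plaqIdx p₁.1 p₁.2.1 p₁.2.2) (polB b) e₁ (B.T a) (pv (braIdx c)))
        (genCLM (G.lnk i₁) (G.pol i₁) e₁ (B.T a) (G.y i₁))) ≠ 0 := by
  intro h0
  apply h
  have hy : G.step.y ⟨e₁, a, i₁, p₁, b, c, mo⟩ = 0 := h0
  unfold nu; rw [hy, norm_zero, mul_zero, mul_zero]

/-- **Structure of a nonzero transfer** `tr p e' i j ≠ 0`: the child `j` was produced from `i` at
`(p, e')`, and the tensor-shift locality (E8) holds between the weights of `i` and `j`. [ours] -/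
theorem tr_locality {p : Site d L × Fin d × Fin d} {e' : Edge d L} {i : G.I} {j : G.CIdx}
    (htr : G.tr p e' i j ≠ 0) :
    (∀ e, e ∉ plaqLinks d L p → G.step.wt j e = G.wt i e) ∧
      ∀ e, G.step.wt j e ≤ G.wt i e + sigmaStar B ∧ G.wt i e ≤ G.step.wt j e + sigmaStar B := by
  obtain ⟨e₁, a, i₁, p₁, b, c, mo⟩ := j
  rcases G.tr_cases p e' i ⟨e₁, a, i₁, p₁, b, c, mo⟩ with h0 | ⟨h1, h2, h3, hval⟩
  · exact absurd h0 htr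
  · simp only at h1 h2 h3
    subst h1 h2 h3
    have hnu : G.step.nu ⟨e₁, a, i₁, p₁, b, c, mo⟩ ≠ 0 := fun h0 => htr (by rw [hval, h0, mul_zero])
    have hu := G.proj_cv_ne_zero e₁ a i₁ p₁ b c mo hnu
    have hw : genCLM (G.lnk i₁) (G.pol i₁) e₁ (B.T a) (G.y i₁)
        ∈ jointSpace (casimirFamily (G.lnk i₁) (G.pol i₁) B) (G.m i₁) :=
      genCLM_mem_jointSpace (G.lnk i₁) (G.pol i₁) B (G.m i₁) e₁ (B.mem a) (jointProj_apply_mem _ _ _)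
    refine ⟨fun e he => ?_, fun e => ?_⟩
    · have hm : ((mo e : ℂ)).re = ((G.m i₁ e : ℂ)).re :=
        mode_eq_of_forall_ne (plaqIdx p₁.1 p₁.2.1 p₁.2.2) (polB b) (G.lnk i₁) (G.pol i₁) B
          (not_mem_plaqLinks.1 he) (G.m i₁) hw _ mo hu
      show Real.sqrt ((mo e : ℂ).re) = Real.sqrt ((G.m i₁ e : ℂ).re)
      rw [hm]
    · have hs : Real.sqrt ((mo e : ℂ).re) ≤ Real.sqrt ((G.m i₁ e : ℂ).re)
            + shiftConst (genNorm (plaqIdx p₁.1 p₁.2.1 p₁.2.2) (polB b) B e)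
              (genNorm (plaqIdx p₁.1 p₁.2.1 p₁.2.2) (polB b) B e ^ 2) ∧
          Real.sqrt ((G.m i₁ e : ℂ).re) ≤ Real.sqrt ((mo e : ℂ).re)
            + shiftConst (genNorm (plaqIdx p₁.1 p₁.2.1 p₁.2.2) (polB b) B e)
              (genNorm (plaqIdx p₁.1 p₁.2.1 p₁.2.2) (polB b) B e ^ 2) :=
        sqrt_mode_shift (plaqIdx p₁.1 p₁.2.1 p₁.2.2) (polB b) (G.lnk i₁) (G.pol i₁) B e (G.m i₁) hw _ mo hu
      have hσ := shiftConst_genNorm_le B (plaqIdx p₁.1 p₁.2.1 p₁.2.2) b e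
      constructor
      · show Real.sqrt ((mo e : ℂ).re) ≤ Real.sqrt ((G.m i₁ e : ℂ).re) + sigmaStar B
        linarith [hs.1]
      · show Real.sqrt ((G.m i₁ e : ℂ).re) ≤ Real.sqrt ((mo e : ℂ).re) + sigmaStar B
        linarith [hs.2]

/-- The total transfer out of parent `i` at `(p, e')` is the emitted sum of `GradedEmission`. [ours] -/
theorem sum_tr_eq (p : Site d L × Fin d × Fin d) (e' : Edge d L) (i : G.I) :
    ∑ j : G.CIdx, G.tr p e' i j
      = ∑ a : B.ι, ∑ b : Bool, ∑ c : Fin n × Fin n × Fin n × Fin n, ∑ mo : G.CModes i p b,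
          G.step.cm ⟨e', a, i, p, b, c, mo⟩ * G.step.nu ⟨e', a, i, p, b, c, mo⟩ := by
  rw [G.sum_CIdx]
  have h1 : ∀ e₁ ≠ e', (∑ a : B.ι, ∑ i₁ : G.I, ∑ p₁ : Site d L × Fin d × Fin d, ∑ b : Bool,
      ∑ c : Fin n × Fin n × Fin n × Fin n, ∑ mo : G.CModes i₁ p₁ b, G.tr p e' i ⟨e₁, a, i₁, p₁, b, c, mo⟩)
        = 0 := by
    intro e₁ he₁
    refine Finset.sum_eq_zero fun a _ => Finset.sum_eq_zero fun i₁ _ => Finset.sum_eq_zero fun p₁ _ =>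
      Finset.sum_eq_zero fun b _ => Finset.sum_eq_zero fun c _ => Finset.sum_eq_zero fun mo _ => ?_
    rw [tr_mk, if_neg he₁]
  refine (Fintype.sum_eq_single e' h1).trans (Finset.sum_congr rfl fun a _ => ?_)
  have h2 : ∀ i₁ ≠ i, (∑ p₁ : Site d L × Fin d × Fin d, ∑ b : Bool, ∑ c : Fin n × Fin n × Fin n × Fin n,
      ∑ mo : G.CModes i₁ p₁ b, G.tr p e' i ⟨e', a, i₁, p₁, b, c, mo⟩) = 0 := by
    intro i₁ hi₁
    refine Finset.sum_eq_zero fun p₁ _ => Finset.sum_eq_zero fun b _ => Finset.sum_eq_zero fun c _ =>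
      Finset.sum_eq_zero fun mo _ => ?_
    rw [tr_mk, if_pos rfl, if_neg hi₁]
  refine (Fintype.sum_eq_single i h2).trans ?_
  have h3 : ∀ p₁ ≠ p, (∑ b : Bool, ∑ c : Fin n × Fin n × Fin n × Fin n,
      ∑ mo : G.CModes i p₁ b, G.tr p e' i ⟨e', a, i, p₁, b, c, mo⟩) = 0 := by
    intro p₁ hp₁
    refine Finset.sum_eq_zero fun b _ => Finset.sum_eq_zero fun c _ => Finset.sum_eq_zero fun mo _ => ?_
    rw [tr_mk, if_pos rfl, if_pos rfl, if_neg hp₁]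
  refine (Fintype.sum_eq_single p h3).trans ?_
  refine Finset.sum_congr rfl fun b _ => Finset.sum_congr rfl fun c _ => Finset.sum_congr rfl fun mo _ => ?_
  rw [tr_mk, if_pos rfl, if_pos rfl, if_pos rfl]

/-- The input link masses are those of `G`. [ours] -/
theorem linkMass_inl (hn : n ≠ 0) (e : Edge d L) :
    (G.weights hn).linkMass (G.live.map ⟨Sum.inl, Sum.inl_injective⟩) (Sum.elim G.nu G.step.nu) e
      = G.mass e := by
  unfold ModeWeights.linkMass mass
  rw [Finset.sum_map]
  rfl

/-- The output link masses are those of `G.step`. [ours] -/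
theorem linkMass_inr (hn : n ≠ 0) (e : Edge d L) :
    (G.weights hn).linkMass (G.step.live.map ⟨Sum.inr, Sum.inr_injective⟩) (Sum.elim G.nu G.step.nu) e
      = G.step.mass e := by
  unfold ModeWeights.linkMass mass
  rw [Finset.sum_map]
  rfl

/-! ## 2. The step is a transfer step -/

/-- **THE STEP `G ↦ G.step` IS A MASS-TRANSFER STEP** with `σ = σ_*`, `γ = n/4`, `Γ = n⁴τ_*/2`, `κ = √(n/4)`,
`D = 4d²` — provided dead data of `G` carry no coefficient. [ours] -/
theorem isTransferStep (hn : n ≠ 0) (hz : ∀ i, G.cm i = 0 → G.z i = 0) :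
    IsTransferStep (plaqComplex d L) (G.weights hn) (sigmaStar B) ((n : ℝ) / 4) (Gam n B)
      (G.live.map ⟨Sum.inl, Sum.inl_injective⟩) (G.step.live.map ⟨Sum.inr, Sum.inr_injective⟩)
      (Sum.elim G.nu G.step.nu) (Sum.elim G.nu G.step.nu) G.trM where
  σ_nonneg := sigmaStar_nonneg B
  γ_pos := by
    have : (0 : ℝ) < n := by exact_mod_cast Nat.pos_of_ne_zero hn
    positivity
  Γ_nonneg := Gam_nonneg B
  ν_nonneg := by
    intro m hm
    rw [Finset.mem_map] at hm
    obtain ⟨i, _, rfl⟩ := hm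
    exact G.nu_nonneg i
  T_nonneg := by
    intro p _ e' nn mm
    rcases nn with i | j
    · rcases mm with i' | j'
      · exact le_rfl
      · exact G.tr_nonneg p e' i j'
    · exact le_rfl
  gap := by
    intro m hm
    rw [Finset.mem_map] at hm
    obtain ⟨j, hj, rfl⟩ := hm
    exact G.step.quarter_le_cm hn hj
  balance := by
    intro m hm
    rw [Finset.mem_map] at hm
    obtain ⟨j, hj, rfl⟩ := hm
    -- normalise the right-hand side
    have hR : ∑ p ∈ (plaqComplex d L).plaqs, ∑ e' ∈ (plaqComplex d L).links p,
        ∑ nn ∈ G.live.map ⟨Sum.inl, Sum.inl_injective⟩, G.trM p e' nn (Sum.inr j)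
        = ∑ p : Site d L × Fin d × Fin d, ∑ e' ∈ plaqLinks d L p, ∑ i ∈ G.live, G.tr p e' i j := by
      refine Finset.sum_congr rfl fun p _ => Finset.sum_congr rfl fun e' _ => ?_
      rw [Finset.sum_map]; rfl
    show G.step.cm j * G.step.nu j ≤ ∑ p ∈ (plaqComplex d L).plaqs, ∑ e' ∈ (plaqComplex d L).links p,
        ∑ nn ∈ G.live.map ⟨Sum.inl, Sum.inl_injective⟩, G.trM p e' nn (Sum.inr j)
    rw [hR]
    obtain ⟨e₁, a, i₁, p₁, b, c, mo⟩ := j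
    have hnn : ∀ p e', ∀ i ∈ G.live, 0 ≤ G.tr p e' i ⟨e₁, a, i₁, p₁, b, c, mo⟩ := fun p e' i _ =>
      G.tr_nonneg p e' i _
    by_cases h : (∃ s, plaqIdx p₁.1 p₁.2.1 p₁.2.2 s = e₁) ∧ G.cm i₁ ≠ 0
    · obtain ⟨hs, hl⟩ := h
      have he₁ : e₁ ∈ plaqLinks d L p₁ := mem_plaqLinks.2 hs
      have hi₁ : i₁ ∈ G.live := G.mem_live.2 hl
      have htr : G.tr p₁ e₁ i₁ ⟨e₁, a, i₁, p₁, b, c, mo⟩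
          = G.step.cm ⟨e₁, a, i₁, p₁, b, c, mo⟩ * G.step.nu ⟨e₁, a, i₁, p₁, b, c, mo⟩ := by
        rw [tr_mk, if_pos rfl, if_pos rfl, if_pos rfl]
      calc G.step.cm ⟨e₁, a, i₁, p₁, b, c, mo⟩ * G.step.nu ⟨e₁, a, i₁, p₁, b, c, mo⟩
          = G.tr p₁ e₁ i₁ ⟨e₁, a, i₁, p₁, b, c, mo⟩ := htr.symm
        _ ≤ ∑ i ∈ G.live, G.tr p₁ e₁ i ⟨e₁, a, i₁, p₁, b, c, mo⟩ :=
            Finset.single_le_sum (hnn p₁ e₁) hi₁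
        _ ≤ ∑ e' ∈ plaqLinks d L p₁, ∑ i ∈ G.live, G.tr p₁ e' i ⟨e₁, a, i₁, p₁, b, c, mo⟩ :=
            Finset.single_le_sum (f := fun e' => ∑ i ∈ G.live, G.tr p₁ e' i ⟨e₁, a, i₁, p₁, b, c, mo⟩)
              (fun e' _ => Finset.sum_nonneg (hnn p₁ e')) he₁
        _ ≤ ∑ p : Site d L × Fin d × Fin d, ∑ e' ∈ plaqLinks d L p,
              ∑ i ∈ G.live, G.tr p e' i ⟨e₁, a, i₁, p₁, b, c, mo⟩ :=
            Finset.single_le_sum (f := fun p => ∑ e' ∈ plaqLinks d L p,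
                ∑ i ∈ G.live, G.tr p e' i ⟨e₁, a, i₁, p₁, b, c, mo⟩)
              (fun p _ => Finset.sum_nonneg fun e' _ => Finset.sum_nonneg (hnn p e')) (Finset.mem_univ p₁)
    · have h0 : G.step.nu ⟨e₁, a, i₁, p₁, b, c, mo⟩ = 0 := by
        rcases not_and_or.1 h with h' | h'
        · exact G.step_nu_eq_zero_of_forall_ne (not_exists.1 h' · ) a i₁ b c mo
        · exact G.step_nu_eq_zero_of_z (hz i₁ (not_not.1 h')) e₁ a p₁ b c mo
      rw [h0, mul_zero]
      exact Finset.sum_nonneg fun p _ => Finset.sum_nonneg fun e' _ => Finset.sum_nonneg (hnn p e')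
  emit := by
    intro p _ e' _ nn hnn
    rw [Finset.mem_map] at hnn
    obtain ⟨i, _, rfl⟩ := hnn
    rw [Finset.sum_map]
    show ∑ j ∈ G.step.live, G.tr p e' i j ≤ Gam n B * G.wt i e' * G.nu i
    calc ∑ j ∈ G.step.live, G.tr p e' i j ≤ ∑ j, G.tr p e' i j :=
          Finset.sum_le_univ_sum_of_nonneg fun j => G.tr_nonneg p e' i j
      _ = _ := G.sum_tr_eq p e' i
      _ ≤ Gam n B * G.wt i e' * G.nu i := G.emit_le i p e'
  local_off := by
    intro p _ e' nn mm hT e he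
    obtain ⟨i, j, rfl, rfl, htr⟩ := G.trM_ne_zero hT
    show G.step.wt j e ≤ G.wt i e
    exact le_of_eq ((G.tr_locality htr).1 e he)
  local_on := by
    intro p _ e' nn mm hT e _
    obtain ⟨i, j, rfl, rfl, htr⟩ := G.trM_ne_zero hT
    exact ((G.tr_locality htr).2 e).1
  tw_le := by
    intro p _ e' nn mm hT
    obtain ⟨i, j, rfl, rfl, htr⟩ := G.trM_ne_zero hT
    have hloc := G.tr_locality htr
    exact (G.weights hn).tw_le_of_local (plaqLinks d L p) (card_plaqLinks_le p) (sigmaStar_nonneg B)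
      (fun e he => le_of_eq (hloc.1 e he).symm) (fun e _ => (hloc.2 e).2)

end Gen

/-! ## 3. The one-step contraction of the link masses -/

/-- The VOLUME-INDEPENDENT rate `θ = 4d² · Γ · (1/κ + 8σ_*/γ)`. [ours] -/
noncomputable def theta (d n : ℕ) (B : SuBasis n) : ℝ :=
  ((4 * (d * d) : ℕ) : ℝ) * Gam n B * (1 / Real.sqrt ((n : ℝ) / 4) + 8 * sigmaStar B / ((n : ℝ) / 4))

/-- `θ ≥ 0`. [ours] -/
theorem theta_nonneg (d n : ℕ) (B : SuBasis n) : 0 ≤ theta d n B := by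
  unfold theta
  have := Gam_nonneg (n := n) B; have := sigmaStar_nonneg B
  positivity

/-- **ONE-STEP CONTRACTION**: `sup_e N_{G.step}(e) ≤ θ · sup_e N_G(e)`. [ours] -/
theorem Gen.step_mass_le {B : SuBasis n} {σ : Type} [Fintype σ] [DecidableEq σ]
    (G : Gen (d := d) (L := L) B σ) (hn : n ≠ 0) (hz : ∀ i, G.cm i = 0 → G.z i = 0) {N : ℝ}
    (hN : ∀ e, G.mass e ≤ N) (e : Edge d L) : G.step.mass e ≤ theta d n B * N := by
  have hN' : ∀ e, (G.weights hn).linkMass (G.live.map ⟨Sum.inl, Sum.inl_injective⟩)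
      (Sum.elim G.nu G.step.nu) e ≤ N := fun e => by rw [G.linkMass_inl hn e]; exact hN e
  have h := linkMass_le (G.isTransferStep hn hz) hN' e
  have hD : (((plaqComplex d L).D : ℕ) : ℝ) = ((4 * (d * d) : ℕ) : ℝ) := rfl
  have hκ : (G.weights hn).κ = Real.sqrt ((n : ℝ) / 4) := rfl
  rw [G.linkMass_inr hn e, hD, hκ] at h
  unfold theta
  exact h

end Summit.Ventures.LatticeQCDFlow.TrivializingMaps.GradedSeries
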